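import Summits.QuantumFields.BalabanUV.T4Continuum.Support.ActivityTermModel

/-!
# NE5 ∕ U3, route P2 — K6 SUPPLEMENT (repair R-b of GAPS G-ne5p2-5, generic part): the term datum RESTRICTED TO A SUBMODULE of the
# operator slot, and its `Geometry` from the LATTICE part of the bookkeeping plus measurability ON THE SUBMODULE ONLY

Cell `pub-balaban`, unit `b2b-balaban-t4-ne5-p2` (NE5 ∕ U3 PROVER seat P2, lineage gen 19).  Summits-side new work (bookkeeping over this lineage's
K6 shapes `ActivityTermDatum` ∕ `ActivityTermSlot` ∕ `ActivityTermModel`, g15; NOT a Literature module; nothing of the manuscripts is asserted).  HONEST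
FRAMING: rung (B)+1 of the FINITE-VOLUME T⁴ programme — NOT infinite volume, NOT mass gap, NOT Clay, NOT NE5.

WHY.  `B13TermDataOpMeasurability` (G-ne5p2-5, p214031) certifies that K6's `TermDatum.Geometry` — whose field `hopm` asks the operator exponent
`x ↦ opForm o x` to be a.e.-strongly measurable for EVERY `o : Op` — is unsatisfiable for the term data of record, because the operator slot of record
`OpDatum (Species …) = ℓ^∞` contains data whose `x`-sections are not measurable.  K6's theorems only ever USE `hopm` at inputs the model actually
reads; the cure that keeps K2's shapes (which quantify over ALL inputs of the slot) is to SHRINK THE SLOT: run the term model on a ℂ-submodule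
`M ⊆ Op` on which measurability holds.  This file is the generic half of that repair:
* §1 `TermDatum.onSub 𝔱 M : TermDatum M Hist …` — the same datum with the five kernel read-outs precomposed with the inclusion `M → Op`;
  `term_onSub` ∕ `opForm_onSub` ∕ `histForm_onSub` ∕ `F_onSub` ∕ `z_onSub` (`rfl`); `readLip_onSub` (the inclusion is an isometry), `refAt_onSub`
  (reference data at `(o.1, h)` are reference data at `(o, h)`);
* §2 `TermDatum.GeometryCore 𝔱 𝔠` — `Geometry` WITHOUT the two input-quantified measurability fields `hopm` ∕ `hhistm` (lattice pseudo-metric,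
  site sums, weights, pins, and the three input-free measurabilities) — and **`geometry_onSub`**: `GeometryCore` + `hopm` ON `M` ONLY + `hhistm`
  ⟹ `(𝔱.onSub M).Geometry 𝔠`; `geometryCore_of_geometry` (the converse direction, for slots where `Geometry` does hold).
Downstream (`B13OpMeasurable`, `B13KPStepTermMeasurable`): `M` := the data with measurable `x`-sections, on which `hopm` is PROVED.
0 sorry; axioms ⊆ {propext, Classical.choice, Quot.sound}.
-/

open MeasureTheory
open scoped BigOperators

namespace Summit.QuantumFields.BalabanUV.T4Continuum.ActivityTermModel

open Literature.MathematicalPhysics.QuantumFieldTheory.Balaban1983to89.T4ActivityTilt (domForm)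

variable {Op Hist ι κ S Ω Ω₀ 𝒴 𝒞 : Type*} [Fintype ι] [Fintype κ] [MeasurableSpace Ω] [MeasurableSpace Ω₀]

namespace TermDatum

section OnSub

variable [NormedAddCommGroup Op] [NormedSpace ℂ Op] (𝔱 : TermDatum Op Hist ι κ S Ω Ω₀ 𝒴 𝒞) (M : Submodule ℂ Op)

/-! ## §1 The datum restricted to a submodule of the operator slot -/

/-- [folklore] **THE TERM DATUM ON A SUBMODULE OF THE OPERATOR SLOT**: every kernel read-out precomposed with the inclusion `M → Op`;
all other fields unchanged. -/
def onSub : TermDatum M Hist ι κ S Ω Ω₀ 𝒴 𝒞 where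
  d := 𝔱.d
  p := 𝔱.p
  q := 𝔱.q
  kL o := 𝔱.kL o.1
  kA o := 𝔱.kA o.1
  kP o := 𝔱.kP o.1
  D := 𝔱.D
  bonds := 𝔱.bonds
  cubes := 𝔱.cubes
  cubes₀ := 𝔱.cubes₀
  τ := 𝔱.τ
  kQ o := 𝔱.kQ o.1
  kR o := 𝔱.kR o.1
  w := 𝔱.w
  kk := 𝔱.kk
  v := 𝔱.v
  read := 𝔱.read
  ν := 𝔱.ν
  F₀ := 𝔱.F₀
  Xf := 𝔱.Xf
  Bf := 𝔱.Bf
  ν₀ := 𝔱.ν₀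
  φ₀ := 𝔱.φ₀
  B₀f := 𝔱.B₀f

/-- [folklore] The operator exponent on the submodule is the ambient one at the included input (`rfl`). -/
theorem opForm_onSub [DecidableEq ι] [DecidableEq κ] (o : M) (x : Ω) : (𝔱.onSub M).opForm o x = 𝔱.opForm o.1 x := rfl
omit [Fintype ι] [Fintype κ] in
/-- [folklore] -/
theorem histForm_onSub (h : Hist) (x : Ω) : (𝔱.onSub M).histForm h x = 𝔱.histForm h x := rfl
/-- [folklore] -/
theorem F_onSub [DecidableEq ι] [DecidableEq κ] (pt : M × Hist) (x : Ω) : (𝔱.onSub M).F pt x = 𝔱.F (pt.1.1, pt.2) x := rfl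
omit [Fintype ι] in
/-- [folklore] -/
theorem z_onSub (o : M) : (𝔱.onSub M).z o = 𝔱.z o.1 := rfl
/-- [folklore] **THE TERM ON THE SUBMODULE IS THE AMBIENT TERM AT THE INCLUDED INPUT** (`rfl`). -/
theorem term_onSub [DecidableEq ι] [DecidableEq κ] (pt : M × Hist) : (𝔱.onSub M).term pt = 𝔱.term (pt.1.1, pt.2) := rfl
omit [Fintype ι] [Fintype κ] in
/-- [folklore] -/
theorem ν_onSub : (𝔱.onSub M).ν = 𝔱.ν := rfl

omit [Fintype ι] [Fintype κ] in
/-- [folklore] **`ReadLip` RESTRICTS** (the inclusion of a submodule is an isometry). -/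
theorem readLip_onSub [NormedAddCommGroup Hist] {𝔠 : TermConsts} {ϱOp ϱHist : ℝ} (h : 𝔱.ReadLip 𝔠 ϱOp ϱHist) :
    (𝔱.onSub M).ReadLip 𝔠 ϱOp ϱHist where
  hkL o o' a' i := by
    have e : ‖o - o'‖ = ‖(o : Op) - (o' : Op)‖ := by rw [Submodule.coe_norm, Submodule.coe_sub]
    rw [e]; exact h.hkL o.1 o'.1 a' i
  hkA o o' i j := by
    have e : ‖o - o'‖ = ‖(o : Op) - (o' : Op)‖ := by rw [Submodule.coe_norm, Submodule.coe_sub]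
    rw [e]; exact h.hkA o.1 o'.1 i j
  hkP o o' a' a'' := by
    have e : ‖o - o'‖ = ‖(o : Op) - (o' : Op)‖ := by rw [Submodule.coe_norm, Submodule.coe_sub]
    rw [e]; exact h.hkP o.1 o'.1 a' a''
  hkQ o o' x Y hY b hb b' hb' := by
    have e : ‖o - o'‖ = ‖(o : Op) - (o' : Op)‖ := by rw [Submodule.coe_norm, Submodule.coe_sub]
    rw [e]; exact h.hkQ o.1 o'.1 x Y hY b hb b' hb'
  hkR o o' x Y hY := by
    have e : ‖o - o'‖ = ‖(o : Op) - (o' : Op)‖ := by rw [Submodule.coe_norm, Submodule.coe_sub]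
    rw [e]; exact h.hkR o.1 o'.1 x Y hY
  hadd := h.hadd
  hunit := h.hunit

/-- [folklore] **REFERENCE DATA RESTRICT**: reference data of the ambient datum at `(o.1, h)` are reference data of the restricted datum
at `(o, h)` (every field reads the same kernels, integrand and normalisation). -/
theorem refAt_onSub [DecidableEq ι] [DecidableEq κ] {𝔠 : TermConsts} {o : M} {h : Hist} (href : 𝔱.RefAt 𝔠 (o.1, h)) :
    (𝔱.onSub M).RefAt 𝔠 (o, h) where
  hL := href.hL
  hRA := href.hRA
  hdA := href.hdA
  hP := href.hP
  hC := href.hC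
  hF := href.hF
  hI' := href.hI'
  hM' := href.hM'
  hφ := href.hφ
  hI0' := href.hI0'
  hM0' := href.hM0'
  hζ := href.hζ

omit [Fintype ι] [Fintype κ] in
/-- [folklore] The amplitudes and the history modulus of the restricted datum are the ambient ones (`rfl`). -/
theorem ampOp_onSub (𝔠 : TermConsts) (ρ₀ : ℝ) : (𝔱.onSub M).ampOp 𝔠 ρ₀ = 𝔱.ampOp 𝔠 ρ₀ := rfl
omit [Fintype ι] [Fintype κ] in
/-- [folklore] -/
theorem ampHist_onSub (𝔠 : TermConsts) (ρ₀ : ℝ) : (𝔱.onSub M).ampHist 𝔠 ρ₀ = 𝔱.ampHist 𝔠 ρ₀ := rfl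

end OnSub

/-! ## §2 `Geometry` without the input-quantified measurability fields, and `Geometry` on a submodule -/

section Core

variable (𝔱 : TermDatum Op Hist ι κ S Ω Ω₀ 𝒴 𝒞) (𝔠 : TermConsts)

/-- [folklore] HYPOTHESIS SHAPE (the LATTICE part of K6's `Geometry`: pseudo-metric, `δ∕8`-rate site sums, potential weights with their bond∕row∕column∕pin
sums, the pins of (2.20), and the three INPUT-FREE measurabilities of the dominating form and of the normalisation's forms — printed KIND, one run;
asserted nowhere).  It is `Geometry` minus the two fields `hopm`∕`hhistm` that quantify over the operator∕history inputs. [folklore] -/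
@[folklore]
structure GeometryCore [DecidableEq κ] [DecidableEq 𝒞] : Prop where
  hd0 : ∀ s t, 0 ≤ 𝔱.d s t
  hsymm : ∀ s t, 𝔱.d s t = 𝔱.d t s
  htri : ∀ s t w, 𝔱.d s w ≤ 𝔱.d s t + 𝔱.d t w
  hKι : ∀ s, ∑ b, Real.exp (-(𝔠.δ / 8 * 𝔱.d s (𝔱.p b))) ≤ 𝔠.K
  hKκ : ∀ s, ∑ a', Real.exp (-(𝔠.δ / 8 * 𝔱.d s (𝔱.q a'))) ≤ 𝔠.K
  hw : ∀ Y ∈ 𝔱.D, 0 ≤ 𝔱.w Y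
  hk : ∀ b b', 0 ≤ 𝔱.kk b b'
  hW : ∀ b, ∑ Y ∈ 𝔱.D.filter (fun Y => b ∈ 𝔱.bonds Y), 𝔱.w Y ≤ 𝔠.W
  hrow : ∀ b, ∑ b', 𝔱.kk b b' ≤ 𝔠.Kk
  hcol : ∀ b', ∑ b, 𝔱.kk b b' ≤ 𝔠.Kk
  hv : ∀ Y ∈ 𝔱.D, 0 ≤ 𝔱.v Y
  hmeet : ∀ Y ∈ 𝔱.D, ∃ c ∈ 𝔱.cubes₀, c ∈ 𝔱.cubes Y
  hpin : ∀ c ∈ 𝔱.cubes₀, ∑ Y ∈ 𝔱.D.filter (fun Y => c ∈ 𝔱.cubes Y), 𝔱.v Y ≤ 𝔠.K''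
  hPm : AEStronglyMeasurable (fun x => domForm (𝔱.Xf x) (𝔱.Bf x)) 𝔱.ν
  hq₀m : ∀ P : Matrix κ κ ℂ, AEStronglyMeasurable (fun y => quad₀ P (𝔱.B₀f y)) 𝔱.ν₀
  hP₀m : AEStronglyMeasurable (fun y => (∑ a, 𝔱.B₀f y a ^ 2) / 2) 𝔱.ν₀

/-- [folklore] A datum with `Geometry` has `GeometryCore` (forget the two input-quantified fields). -/
theorem geometryCore_of_geometry [NormedAddCommGroup Op] [NormedSpace ℂ Op] [DecidableEq ι] [DecidableEq κ] [DecidableEq 𝒞]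
    (h : 𝔱.Geometry 𝔠) : 𝔱.GeometryCore 𝔠 :=
  ⟨h.hd0, h.hsymm, h.htri, h.hKι, h.hKκ, h.hw, h.hk, h.hW, h.hrow, h.hcol, h.hv, h.hmeet, h.hpin, h.hPm, h.hq₀m, h.hP₀m⟩

/-- [folklore] **`Geometry` ON A SUBMODULE OF THE OPERATOR SLOT** from the lattice part, the measurability of the operator exponent FOR THE
INPUTS OF THE SUBMODULE ONLY, and the measurability of the history exponent for every history datum (for the measurable table space the latter
is leaf-08's `histm_toTermDatum`).  This is the shape K6's `norm_term_sub_le` ∕ `activityLipschitz₂_model` consume, now satisfiable. -/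
theorem geometry_onSub [NormedAddCommGroup Op] [NormedSpace ℂ Op] [DecidableEq ι] [DecidableEq κ] [DecidableEq 𝒞] (M : Submodule ℂ Op)
    (hcore : 𝔱.GeometryCore 𝔠) (hopm : ∀ o : M, AEStronglyMeasurable (fun x => 𝔱.opForm o.1 x) 𝔱.ν)
    (hhistm : ∀ h : Hist, AEStronglyMeasurable (fun x => 𝔱.histForm h x) 𝔱.ν) : (𝔱.onSub M).Geometry 𝔠 where
  hd0 := hcore.hd0
  hsymm := hcore.hsymm
  htri := hcore.htri
  hKι := hcore.hKι
  hKκ := hcore.hKκ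
  hw := hcore.hw
  hk := hcore.hk
  hW := hcore.hW
  hrow := hcore.hrow
  hcol := hcore.hcol
  hv := hcore.hv
  hmeet := hcore.hmeet
  hpin := hcore.hpin
  hPm := hcore.hPm
  hopm o := hopm o
  hhistm h := hhistm h
  hq₀m := hcore.hq₀m
  hP₀m := hcore.hP₀m

end Core

end TermDatum

end Summit.QuantumFields.BalabanUV.T4Continuum.ActivityTermModel
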